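import Summits.QuantumFields.BalabanUV.Beta.EriceRemainderEnclosureHistoryAutonomyComparisonAgeCompositionTwoAgesOldRead

/-!
# EriceRemainderEnclosureHistoryAutonomyComparisonAgeCompositionTwoAgesFar — (E91b) route (N), first order: THE END BEYOND MASS ONE — TWO AGES AT EVERY
# RATIO.  For a profile carried by two ages `i < k` with `k ≥ 24·i` the first-order comparison surplus satisfies `0 ≤ ε ≤ e` along EVERY admissible flow,
# for EVERY horizon and EVERY damping of the self-consistent class `g_t·(1 + F_t) ≥ 1` (`F_t = Σ_j L_j h_{t+j}³∕2`), WHATEVER THE TOTAL WINDOW LOAD — by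
# the YOUNG CONTRACTION (`x_i ≤ √2∕2`) against an old read that is a SLOWLY VARYING WINDOW AVERAGE (it moves by at most `4·(i∕k)·x_k·e` across the young
# window); with (E90c) `flow_nonneg_two_ages` (`k ≤ 133·i`, total load `≤ 1`) this is the two-age END at EVERY ratio — the first `K`-uniform END of
# route (N) for a profile that is not fading

Cell `pub-balaban`, β-function sub-cell, BINDER row D4 «RemainderConst leaves for Bałaban's split» (`HOME/BINDER-OWNERS.md`; owner lineage `b2b-balaban-beta-an4`;
this file by co-owner #2 lineage `b2b-balaban-beta-d4-p2`, generation 82), β-FLOW TEAM duty (1), FREEZE (0) honoured (def-free; nothing restated).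

HONEST FRAMING (page 1, verbatim and binding).  *"Discharging BetaPertH makes Bałaban's UV stability UNCONDITIONAL — a real constructive-QFT result; it is
NOT the continuum limit and NOT the Clay problem."*  THIS FILE DISCHARGES NOTHING OF THE KIND.  Elementary real algebra ∕ real analysis about ABSTRACT
functionals on a box ]0,γ]^ℕ with displayed floors, profiles and signs, and the FIRST-ORDER renewal objects of route (N) built from them — hypotheses of a
census, not facts; the form, signs, ages and moments of Bałaban's (1.22) limit functional are NOT PRINTED ([I] p. 298; GAPS G-t4-U2-1∕-2) and NOT asserted.
Row D4 class UNCHANGED (critical-path width 0; instance 0∕1; D4 DISCHARGE NO DATE).  HONEST DEPENDENCY: continuum YM on T⁴ ⇐ BetaPertH ∧ nine spine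
estimates (0/9 proved); BetaPertH ⇐ (D1) ∧ (D4) ∧ CAP+tail; G-an2-4 gates asym, D1 and NE2/3/4.

THE POINT (README `HOME/b2b-balaban-beta-d4-p2/g82/e91/README.md`).  Every END of route (N) in the tree so far rests on a ROW MASS `≤ 1` ((E86i) light load,
(E89b)∕(E90c,d) total window load `≤ 1`) — true for every profile of range `≤ 52`, for two ages up to ratio `133`, FALSE along admissible flows beyond
`k ≈ 5·10³` (README g80∕e89 §4(d)) — or on a FADING profile ((E60), (E70c)).  The numerics of generation 82 (`g82/numerics/ren1–4.py`) show that positivity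
does NOT die with the mass: on the LP-worst young+old flows the all-ones renewal solution has `min u = 0.41∕0.37∕0.34∕0.32` at `k = 256∕1024∕4096∕16384`
(total load `0.84∕0.92∕0.99∕1.04`), always at the pin `m = 0` with the horizon `n = k` (old window exactly filled); inside the self-consistent damping
class the minimum moves by `< 0.003`; an ARBITRARY damping in `]0,1]` (one killed scale just beyond the old window) cuts it to `0.20∕0.13∕0.10` at
`k = 512∕2048∕8192`.  THE MECHANISM typed here: at pin `m` the young read is `Σ_{l<i} wy·ε_{m+1+l}` with `Σ wy ≤ x_i(m) ≤ √2∕2`, and each young target obeys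
`ε_{m+1+l} ≤ e − O(m+1+l)` where `O` is the OLD read; so `ε_m ≥ (1 − x_i)(e_m − O(m)) − x_i·max_l (O(m) − O(m+1+l))`, and `O(m) ≤ x_k·e ≤ (√2∕2)e` while the
old read VARIES SLOWLY: `O(m) − O(m+d) ≤ 4d·c_k(m)·e_m ≤ 4(i∕k)·x_k(m)·e_m` (`d ≤ i`; entering targets `d·c_k`, level persistence `(k∕(k+d))²`, damping
persistence `Π g ≥ (m+k+2)∕(m+k+d+2) ≥ k∕(k+d)` from `g_t ≥ 1 − F_t ≥ (t+1)∕(t+2)` — the lag-zero weight `F_t ≤ 1 − a_t∕a_{t+1} ≤ 1∕(t+1)`).  The margin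
`(1 − √2∕2)² = 3∕2 − √2 ≥ 1∕12 ≥ (√2∕2)·(4i∕k)·(√2∕2)` closes for `k ≥ 24i`.  Uses (E91a) `old_read_variation`, (E89b)
`window_load_le_sqrt_two_div_two`, (E82a) `kernel_entry_le`∕`row_mass_le`, (E80b) `aggregate_eq_sum`, (E90c) `flow_nonneg_two_ages` BY NAME.  NOT CLAIMED: three or more ages; arbitrary dampings in `]0,1]` beyond ratio 133; anything printed — NOT B12 Thm 2, NOT BetaPertH.

WHAT IS PROVED ([folklore]; 0 `def`, 0 sorry).  §1 (pure) **`renewal_nonneg_two_reads`**.  §2 **`flow_nonneg_two_ages_far`** (`k ≥ 24i`),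
**`flow_nonneg_two_ages_all`** (every ratio).
-/
noncomputable section
open Finset

namespace Summit.QuantumFields.BalabanUV.Beta.EriceRemainderEnclosureHistoryAutonomyComparisonAgeCompositionTwoAgesFar

open Literature.MathematicalPhysics.QuantumFieldTheory.Balaban1983to89
open Literature.MathematicalPhysics.QuantumFieldTheory.Balaban1983to89.T4BetaStationary
open Literature.MathematicalPhysics.QuantumFieldTheory.Balaban1983to89.T4BetaFlowWellPosed
open Summit.QuantumFields.BalabanUV.Beta.EriceRemainderEnclosureHistoryAutonomyComparisonAgeCompositionTwoAgesOldRead (old_read_variation)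
open Summit.QuantumFields.BalabanUV.Beta.EriceRemainderEnclosureHistoryAutonomyComparisonAgeCompositionThreeAgesMassCap
  (window_load_le_sqrt_two_div_two)
open Summit.QuantumFields.BalabanUV.Beta.EriceRemainderEnclosureHistoryAutonomyComparisonAgeCompositionYoungestTailSumFlow
  (kernel_entry_le row_mass_le)
open Summit.QuantumFields.BalabanUV.Beta.EriceRemainderEnclosureHistoryAutonomyComparisonAgeCompositionChainWiring (aggregate_eq_sum)
open Summit.QuantumFields.BalabanUV.Beta.EriceRemainderEnclosureHistoryAutonomyComparisonAgeCompositionThreeAgesTotalLoad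
  (flow_nonneg_two_ages)

variable {B : (ℕ → ℝ) → ℝ} {γ b gIR : ℝ} {L : ℕ → ℝ} {K : ℕ} {h g : ℕ → ℝ}

/-! ## §1 The pure mechanism: young contraction against a slowly varying old read -/

/-- **POSITIVITY FROM A YOUNG CONTRACTION AND A SLOWLY VARYING OLD READ (pure).**  `ε_m = e_m − Y_m − O_m` for every `m`, `ε_m = 0` beyond `N`,
`e ≥ 0` non-increasing; the young read `Y_m = Σ_l wy_{m,l}·ε_{m+1+l}` has non-negative weights vanishing for `l ≥ i` and row sums `≤ sy ≤ 1`; the old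
read `O_m = Σ_l wo_{m,l}·ε_{m+1+l}` has non-negative weights with row sums `≤ so ≤ 1`; and whenever `0 ≤ ε ≤ e` holds beyond `m`, the old read varies
by at most `V·e_m` across the young window: `O_m − O_{m+d} ≤ V·e_m` (`1 ≤ d ≤ i`).  If `sy·V ≤ (1 − sy)(1 − so)` then `0 ≤ ε_m ≤ e_m` at every pin —
WHATEVER the total mass `sy + so`. [folklore] -/
theorem renewal_nonneg_two_reads {i N Kw : ℕ} {sy so V : ℝ} {wy wo : ℕ → ℕ → ℝ} {Y O e ε : ℕ → ℝ}
    (hwy0 : ∀ m l, 0 ≤ wy m l) (hwyi : ∀ m l, i ≤ l → wy m l = 0) (hWy : ∀ m, ∑ l ∈ range Kw, wy m l ≤ sy)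
    (hwo0 : ∀ m l, 0 ≤ wo m l) (hWo : ∀ m, ∑ l ∈ range Kw, wo m l ≤ so)
    (hsy : sy ≤ 1) (hso : so ≤ 1) (hV : 0 ≤ V) (hcond : sy * V ≤ (1 - sy) * (1 - so))
    (hY : ∀ m, Y m = ∑ l ∈ range Kw, wy m l * ε (m + 1 + l)) (hO : ∀ m, O m = ∑ l ∈ range Kw, wo m l * ε (m + 1 + l))
    (he0 : ∀ m, 0 ≤ e m) (hea : ∀ m, e (m + 1) ≤ e m)
    (hvar : ∀ m d, 1 ≤ d → d ≤ i → (∀ q, m < q → 0 ≤ ε q ∧ ε q ≤ e q) → O m - O (m + d) ≤ V * e m)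
    (hεt : ∀ m, N < m → ε m = 0) (hrec : ∀ m, ε m = e m - Y m - O m) : ∀ m, 0 ≤ ε m ∧ ε m ≤ e m := by
  have hea' : ∀ p q, p ≤ q → e q ≤ e p := by
    intro p q hpq
    induction q, hpq using Nat.le_induction with
    | base => exact le_rfl
    | succ q _ ih => exact (hea q).trans ih
  -- the step at one pin, given the bounds beyond it
  have step : ∀ m, (∀ q, m < q → 0 ≤ ε q ∧ ε q ≤ e q) → 0 ≤ ε m ∧ ε m ≤ e m := by
    intro m IH
    have hYnn : 0 ≤ Y m := by
      rw [hY]; exact sum_nonneg fun l _ => mul_nonneg (hwy0 m l) (IH _ (by omega)).1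
    have hOnn : 0 ≤ O m := by
      rw [hO]; exact sum_nonneg fun l _ => mul_nonneg (hwo0 m l) (IH _ (by omega)).1
    have hOle : O m ≤ so * e m := by
      rw [hO]
      calc ∑ l ∈ range Kw, wo m l * ε (m + 1 + l) ≤ ∑ l ∈ range Kw, wo m l * e m :=
            sum_le_sum fun l _ => mul_le_mul_of_nonneg_left
              (((IH _ (by omega)).2).trans (hea' m (m + 1 + l) (by omega))) (hwo0 m l)
        _ = (∑ l ∈ range Kw, wo m l) * e m := by rw [sum_mul]
        _ ≤ so * e m := mul_le_mul_of_nonneg_right (hWo m) (he0 m)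
    -- the young targets carry their own old read
    have hup : ∀ l, l < i → ε (m + 1 + l) ≤ e m - O (m + 1 + l) := by
      intro l _
      have hYp : 0 ≤ Y (m + 1 + l) := by
        rw [hY]; exact sum_nonneg fun l' _ => mul_nonneg (hwy0 _ l') (IH _ (by omega)).1
      rw [hrec (m + 1 + l)]
      have := hea' m (m + 1 + l) (by omega)
      linarith
    set Wy := ∑ l ∈ range Kw, wy m l with hWy_def
    have hWy1 : Wy ≤ sy := hWy m
    have hWy0 : 0 ≤ Wy := sum_nonneg fun l _ => hwy0 m l
    have hYle : Y m ≤ Wy * e m - ∑ l ∈ range Kw, wy m l * O (m + 1 + l) := by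
      rw [hY, hWy_def, sum_mul, ← sum_sub_distrib]
      refine sum_le_sum fun l _ => ?_
      by_cases hl : l < i
      · have h1 := hup l hl
        have h2 := hwy0 m l
        nlinarith
      · rw [hwyi m l (not_lt.mp hl)]; simp
    have hvar' : ∑ l ∈ range Kw, wy m l * (O m - O (m + 1 + l)) ≤ Wy * (V * e m) := by
      rw [hWy_def, sum_mul]
      refine sum_le_sum fun l _ => ?_
      by_cases hl : l < i
      · have := hvar m (l + 1) (by omega) (by omega) IH
        rw [show m + 1 + l = m + (l + 1) by ring]
        exact mul_le_mul_of_nonneg_left this (hwy0 m l)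
      · rw [hwyi m l (not_lt.mp hl)]; simp
    have hsum : ∑ l ∈ range Kw, wy m l * O (m + 1 + l) = Wy * O m - ∑ l ∈ range Kw, wy m l * (O m - O (m + 1 + l)) := by
      rw [hWy_def, sum_mul, ← sum_sub_distrib]
      exact sum_congr rfl fun l _ => by ring
    have hεm : ε m = e m - Y m - O m := hrec m
    have key : (1 - Wy) * (e m - O m) - Wy * (V * e m) ≤ ε m := by
      rw [hεm]; linarith [hYle, hvar', hsum]
    refine ⟨?_, ?_⟩
    · have h1 : (1 - so) * e m ≤ e m - O m := by linarith
      have h2 : (1 - Wy) * ((1 - so) * e m) ≤ (1 - Wy) * (e m - O m) :=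
        mul_le_mul_of_nonneg_left h1 (by linarith [hWy1, hsy])
      have h3 : Wy * V ≤ (1 - Wy) * (1 - so) := by nlinarith [hcond, hWy1, hso, hV]
      have h4 : 0 ≤ ((1 - Wy) * (1 - so) - Wy * V) * e m := mul_nonneg (by linarith) (he0 m)
      nlinarith [key, h2, h4]
    · rw [hεm]; linarith [hYnn, hOnn]
  -- downward induction from the horizon
  have main : ∀ n m, N < m + n → 0 ≤ ε m ∧ ε m ≤ e m := by
    intro n
    induction n with
    | zero => intro m hm; rw [hεt m (by omega)]; exact ⟨le_rfl, he0 m⟩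
    | succ n ih => intro m hm; exact step m fun q hq => ih q (by omega)
  exact fun m => main (N + 1) m (by omega)

/-! ## §2 The END: two ages far apart, and two ages at every ratio -/

/-- **THE TWO-AGE END ALONG EVERY FLOW FOR `k ≥ 24·i` — EVERY HORIZON, EVERY DAMPING OF THE SELF-CONSISTENT CLASS, WHATEVER THE TOTAL LOAD.**  For the
isotone dominated memory with floor and the profile carried by `{i, k}` (`1 ≤ i`, `24i ≤ k < K`), dampings with `g_t(1 + F_t) ≥ 1` (`F_t = Σ_j L_j h_{t+j}³∕2`,
the class of (E75a): `g = 1∕(1+f)`, `0 ≤ f ≤ F`), the comparison surplus of every admissible excess satisfies `0 ≤ ε ≤ e` at every pin (§1 with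
`sy = so = √2∕2`, `V = √2∕12`; the variation bound is (E91a) `old_read_variation`). [folklore] -/
theorem flow_nonneg_two_ages_far (hmono : ∀ u v : ℕ → ℝ, SeqBox γ u → SeqBox γ v → (∀ j, u j ≤ v j) → B u ≤ B v)
    (hL : ∀ k, 0 ≤ L k) (hb : 0 < b) (hlo : ∀ u, SeqBox γ u → b ≤ B u) (hdom : ∀ u, SeqBox γ u → ∑ k ∈ range K, L k * u k ≤ B u)
    (hh : SeqBox γ h) (hf : MemFlow B gIR h) (hg : ∀ t, 0 < g t ∧ g t ≤ 1)
    (hgF : ∀ t, 1 ≤ g t * (1 + ∑ k ∈ range K, L k * h (t + k) ^ 3 / 2))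
    {i k : ℕ} (hi : 1 ≤ i) (hik : 24 * i ≤ k) (hkK : k < K) (hL2 : ∀ l, l < K → l ≠ i → l ≠ k → L l = 0)
    {N : ℕ} {KL : ℕ → ℕ → ℕ → ℝ}
    (hKL : ∀ k n l, KL k n l = if 0 < k ∧ k < K ∧ l < k then L k * h (n + k) ^ 3 / 2 * ∏ t ∈ Ico (n + 1 + l) (n + k + 1), g t else 0)
    {KA : ℕ → ℕ → ℕ → ℝ} {RA : ℕ → (ℕ → ℝ) → ℕ → ℝ}
    (hRA : ∀ i v m, RA i v m = ∑ l ∈ range K, KA i m l * v (m + 1 + l))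
    (hKA : ∀ i m l, KA i m l = KL i m l + KA (i + 1) m l) (hKAtop : ∀ m l, KA K m l = 0)
    {e ε : ℕ → ℝ} (he0 : ∀ m, 0 ≤ e m) (hea : ∀ m, e (m + 1) ≤ e m)
    (hεt : ∀ m, N < m → ε m = 0) (hεrec : ∀ m, ε m = e m - RA 1 ε m) : ∀ m, 0 ≤ ε m ∧ ε m ≤ e m := by
  have hpos : ∀ n, 0 < h n := fun n => (hh n).1
  have hiK : i < K := by omega
  have hk : 0 < k := by omega
  have hK : 1 ≤ K := by omega
  have hL0 : L 0 = 0 := hL2 0 (by omega) (by omega) (by omega)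
  have hs2 : Real.sqrt 2 ^ 2 = 2 := Real.sq_sqrt (by norm_num)
  have hs0 : 0 ≤ Real.sqrt 2 := Real.sqrt_nonneg 2
  have hs17 : Real.sqrt 2 ≤ 17 / 12 := Real.sqrt_le_iff.mpr ⟨by norm_num, by norm_num⟩
  -- the aggregate row is the young row plus the old row
  have hKA1 : ∀ m l, KA 1 m l = KL i m l + KL k m l := by
    intro m l
    have h1 : KA 1 m l = ∑ k' ∈ Ico 1 (K - 1 + 1), KL k' m l :=
      aggregate_eq_sum (n := K - 1) hKA (fun m l => by rw [Nat.sub_add_cancel hK]; exact hKAtop m l) (show 1 ≤ K - 1 + 1 by omega) m l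
    rw [h1, Nat.sub_add_cancel hK]
    have hsub : ({i, k} : Finset ℕ) ⊆ Ico 1 K := by
      intro j hj
      simp only [mem_insert, mem_singleton] at hj
      rw [mem_Ico]; rcases hj with rfl | rfl <;> omega
    rw [← sum_subset hsub (fun j hj hjn => by
      simp only [mem_insert, mem_singleton, not_or] at hjn
      rw [hKL]
      split_ifs
      · rw [hL2 j (mem_Ico.mp hj).2 hjn.1 hjn.2]; simp
      · rfl), sum_pair (by omega)]
  refine renewal_nonneg_two_reads (i := i) (N := N) (Kw := K) (sy := Real.sqrt 2 / 2) (so := Real.sqrt 2 / 2) (V := Real.sqrt 2 / 12)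
    (wy := fun m l => KL i m l) (wo := fun m l => KL k m l)
    (Y := fun m => ∑ l ∈ range K, KL i m l * ε (m + 1 + l)) (O := fun m => ∑ l ∈ range K, KL k m l * ε (m + 1 + l))
    (fun m l => (kernel_entry_le hL hh hg hKL i m l).1) (fun m l hl => by rw [hKL, if_neg (by omega)])
    (fun m => (row_mass_le hL hh hg hKL hiK m).trans (window_load_le_sqrt_two_div_two hmono hL hb hlo hdom hh hf hiK m))
    (fun m l => (kernel_entry_le hL hh hg hKL k m l).1)
    (fun m => (row_mass_le hL hh hg hKL hkK m).trans (window_load_le_sqrt_two_div_two hmono hL hb hlo hdom hh hf hkK m))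
    (by linarith [hs17]) (by linarith [hs17]) (by positivity) (by nlinarith [hs2, hs17]) (fun _ => rfl) (fun _ => rfl) he0 hea ?_ hεt ?_
  · -- the slowly varying old read: 4 d c_k(m) e_m ≤ (4i∕k)·x_k(m)·e_m ≤ (√2∕12)·e_m
    intro m d hd1 hdi IH
    have hdk : d ≤ k := by omega
    have hv := old_read_variation hmono hL hb hlo hdom hh hf hL0 hg hgF hKL hk hkK hd1 hdk he0 hea IH
    have hx := window_load_le_sqrt_two_div_two hmono hL hb hlo hdom hh hf hkK m
    have hc0 : 0 ≤ L k * h (m + k) ^ 3 / 2 := by have := hL k; have := hpos (m + k); positivity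
    have hem := he0 m
    have hkr : (0 : ℝ) < k := by exact_mod_cast hk
    have hdi' : (24 : ℝ) * d ≤ k := by exact_mod_cast (le_trans (Nat.mul_le_mul_left 24 hdi) hik)
    have e1 : ∑ l ∈ range K, KL k (m + d) l * ε (m + d + 1 + l) = (fun m => ∑ l ∈ range K, KL k m l * ε (m + 1 + l)) (m + d) := rfl
    -- 4 d c e ≤ (4d∕k)(k c) e ≤ (1∕6)(√2∕2) e
    have h4 : 4 * (d : ℝ) * (L k * h (m + k) ^ 3 / 2) * e m ≤ Real.sqrt 2 / 12 * e m := by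
      have : 4 * (d : ℝ) * (L k * h (m + k) ^ 3 / 2) ≤ Real.sqrt 2 / 12 := by
        have h24 : 4 * (d : ℝ) * (L k * h (m + k) ^ 3 / 2) * 6 ≤ (k : ℝ) * (L k * h (m + k) ^ 3 / 2) := by nlinarith
        nlinarith
      exact mul_le_mul_of_nonneg_right this hem
    simpa using hv.trans h4
  · intro m
    rw [hεrec m, hRA]
    have : ∑ l ∈ range K, KA 1 m l * ε (m + 1 + l)
        = ∑ l ∈ range K, KL i m l * ε (m + 1 + l) + ∑ l ∈ range K, KL k m l * ε (m + 1 + l) := by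
      rw [← sum_add_distrib]; exact sum_congr rfl fun l _ => by rw [hKA1]; ring
    rw [this]; ring

/-- **THE TWO-AGE END AT EVERY RATIO — EVERY HORIZON, EVERY DAMPING OF THE SELF-CONSISTENT CLASS.**  `1 ≤ i < k < K`, profile carried by `{i, k}`:
`0 ≤ ε ≤ e` at every pin — (E90c) `flow_nonneg_two_ages` (total load `≤ 1`) for `k ≤ 133i`, `flow_nonneg_two_ages_far` beyond.  The first END of
route (N) that is uniform in the range for a profile that is not fading. [folklore] -/
theorem flow_nonneg_two_ages_all (hmono : ∀ u v : ℕ → ℝ, SeqBox γ u → SeqBox γ v → (∀ j, u j ≤ v j) → B u ≤ B v)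
    (hL : ∀ k, 0 ≤ L k) (hb : 0 < b) (hlo : ∀ u, SeqBox γ u → b ≤ B u) (hdom : ∀ u, SeqBox γ u → ∑ k ∈ range K, L k * u k ≤ B u)
    (hh : SeqBox γ h) (hf : MemFlow B gIR h) (hg : ∀ t, 0 < g t ∧ g t ≤ 1)
    (hgF : ∀ t, 1 ≤ g t * (1 + ∑ k ∈ range K, L k * h (t + k) ^ 3 / 2))
    {i k : ℕ} (hi : 1 ≤ i) (hik : i < k) (hkK : k < K) (hL2 : ∀ l, l < K → l ≠ i → l ≠ k → L l = 0)
    {N : ℕ} (hKN : K ≤ N) {KL : ℕ → ℕ → ℕ → ℝ}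
    (hKL : ∀ k n l, KL k n l = if 0 < k ∧ k < K ∧ l < k then L k * h (n + k) ^ 3 / 2 * ∏ t ∈ Ico (n + 1 + l) (n + k + 1), g t else 0)
    {KA : ℕ → ℕ → ℕ → ℝ} {RA : ℕ → (ℕ → ℝ) → ℕ → ℝ}
    (hRA : ∀ i v m, RA i v m = ∑ l ∈ range K, KA i m l * v (m + 1 + l))
    (hKA : ∀ i m l, KA i m l = KL i m l + KA (i + 1) m l) (hKAtop : ∀ m l, KA K m l = 0)
    {e ε : ℕ → ℝ} (he0 : ∀ m, 0 ≤ e m) (hea : ∀ m, e (m + 1) ≤ e m)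
    (hεt : ∀ m, N < m → ε m = 0) (hεrec : ∀ m, ε m = e m - RA 1 ε m) : ∀ m, 0 ≤ ε m ∧ ε m ≤ e m := by
  by_cases hratio : (k : ℝ) ≤ 133 * i
  · exact flow_nonneg_two_ages hmono hL hb hlo hdom hh hf hg hi hik hkK hratio hL2 hKN hKL hRA hKA hKAtop he0 hea hεt hεrec
  · have hfar : 24 * i ≤ k := by
      have : (133 : ℝ) * i < k := lt_of_not_ge hratio
      have : (24 : ℝ) * i ≤ k := by have hi0 : (0 : ℝ) ≤ i := Nat.cast_nonneg i; linarith
      exact_mod_cast this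
    exact flow_nonneg_two_ages_far hmono hL hb hlo hdom hh hf hg hgF hi hfar hkK hL2 hKL hRA hKA hKAtop he0 hea hεt hεrec

end Summit.QuantumFields.BalabanUV.Beta.EriceRemainderEnclosureHistoryAutonomyComparisonAgeCompositionTwoAgesFar

end
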